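import Summits.Langlands.Langlands.Theses.DyadicOddResidue
import Literature.NumberTheory.Automorphic.FontaineMazurGL2OddPrime
import Literature.NumberTheory.Automorphic.SerreConjecture
import Literature.NumberTheory.GaloisRepresentations.OrdinaryTwistedDeterminant
import Literature.NumberTheory.GaloisRepresentations.CalegariEvenFontaineMazurTwo
import Summits.Langlands.Langlands.Theorems.ParityBlindBianchiResidualBianchiDoorMod2SerreKW
import Summits.Langlands.Langlands.Theorems.ParityBlindBianchiResidualBianchiDoorMod2ReducibleSolvable
import Literature.NumberTheory.EllipticCurves.NewformGaloisRepModLOfPadicAlgClProofs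
import Summits.Langlands.Langlands.Theorems.DyadicOddResidueOddPrimesRegularFMDictionary
import Literature.NumberTheory.GaloisRepresentations.CyclotomicCharacterFrobeniusProofs
import Literature.NumberTheory.Automorphic.AlgebraicityParityGL
import HarnessLib

/-!
# Sketch — crux-ideate `stmt-Langlands-18744` (`DyadicOddResidue.DyadicNonsolvableFM`), ideator 2

Idea `serre-avatar-modus-ponens`: render Tung 2020's residual-modularity hypothesis "ρ̄ is modular"
as SERRE-MODULARITY (a.e. Frobenius characteristic polynomials, `IsGaloisRepOfNewform1Int`) of a
mod-2 AVATAR of `ρ.residualRep`, so that the in-tree named fact `khare_wintenberger 2 k` discharges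
it by modus ponens.  This file only checks that the proposed statements ELABORATE:

* `IsSerreModularTwo τ` — the Serre-shaped residual hypothesis (verbatim the conclusion of the weak
  form of `SerreModularityConjecture 2 k`, cf. the in-tree theorems
  `serreModularityTwoLe_of_khareWintenberger`, `exists_newform_of_khare_wintenberger_two`);
* `FirstLemma` — the Serre avatar: for `ρ : Γ_ℚ → GL₂(ℚ̄₂)` with non-solvable residual image and any
  discrete `k ⊇ ℤ̄₂/𝔪` of characteristic `2`, the push-forward of `ρ.residualRep` is a CONTINUOUS,
  IRREDUCIBLE, ODD `τ : FramedGaloisRep ℚ k 2` (open kernel; `isSolvable_range_of_not_isIrreducible`;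
  `isOdd_of_charP_two`);
* `Tung2020Shape` — the proposed shape of the named fact to vendor (Tung, Math. Z. 298 (2021)
  = arXiv:1908.06174, Thm. 1 p.4 / Thm. 8.0.4 p.32 with `F = ℚ`), Tate-twist conclusion in the
  rendering of `XZhang2024_fontaineMazurGL2_oddPrime` / `oddPrimesRegularFM_of_tateTwistModularity`;
* `LineShape` — the composition the crux-plan stage would have to prove.
-/

noncomputable section

open scoped MatrixGroups NumberField
open NumberField IsDedekindDomain Filter CongruenceSubgroup Field
open Literature.NumberTheory.GaloisRepresentations Literature.NumberTheory.Automorphic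
  Literature.NumberTheory.EllipticCurves.ModularForms

namespace Summit.Langlands.Langlands.Cruxes.DyadicNonsolvableFM.SerreAvatar

set_option linter.dupNamespace false

/-- **Serre-modularity of a mod-2 `τ : Γ_ℚ → GL₂(k)`**: some newform `g ∈ S_w(Γ₁(N))` and
`ι_g : 𝓞_g →+* k` with `τ` attached to `g` away from `2N` (`IsGaloisRepOfNewform1Int`: unramified at
`q ∤ 2N` with `charpoly τ(Frob_q) = ι_g(X² - a_q X + ε(q) q^{w-1})`).  Verbatim the conclusion of the
weak form of `SerreModularityConjecture 2 k`. [folklore] -/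
def IsSerreModularTwo {k : Type} [Field k] [TopologicalSpace k] (τ : FramedGaloisRep ℚ k 2) : Prop :=
  ∃ (N : ℕ) (_ : NeZero N) (w : ℕ) (g : CuspForm (Gamma1 N) (w : ℤ))
    (ιg : coeffCharIntegers g →+* k), IsNewform1 g ∧ IsGaloisRepOfNewform1Int g ιg {q | q ∣ N * 2} τ

/-- **FIRST LEMMA of the line (the Serre avatar).**  For `ρ : Γ_ℚ → GL₂(ℚ̄₂)` continuous with
non-solvable residual image and every discrete field `k` of characteristic `2` receiving `ℤ̄₂/𝔪`
along `ι`, the push-forward `GL₂(ι) ∘ ρ.residualRep` underlies a continuous `τ : FramedGaloisRep ℚ k 2`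
(open kernel: `residualRep` is a semisimplification of the reduction of an integral model, whose kernel
is open, and `ker τ₀ ≤ ker residualRep`), which is irreducible (a reducible `GL₂`-representation has
solvable image, in-tree `isSolvable_range_of_not_isIrreducible`, and `GL₂(ι)` is injective) and odd
(`-1 = 1`, in-tree `isOdd_of_charP_two`). [folklore] -/
def FirstLemma : Prop :=
  ∀ (ρ : FramedGaloisRep ℚ (PadicAlgCl 2) 2), ¬ IsSolvable ρ.residualRep.range →
    ∀ (k : Type) [Field k] [TopologicalSpace k] [DiscreteTopology k] [CharP k 2]
      (ι : padicAlgClResidueField 2 →+* k),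
      ∃ τ : FramedGaloisRep ℚ k 2,
        (τ : absoluteGaloisGroup ℚ →* GL (Fin 2) k) =
            (Matrix.GeneralLinearGroup.map ι).comp ρ.residualRep ∧
          τ.toGaloisRep.IsIrreducible ∧ τ.IsOdd

/-- **Proposed shape of the named fact `Tung2020_fontaineMazurGL2_two`** (Tung 2020, Thm. 1 = the
case `F = ℚ` of Thm. 8.0.4: `p = 2`; `ρ` finitely ramified, odd (kept in characteristic `0`), de Rham at
`2` with distinct labelled Hodge–Tate weights, `ρ̄` with NON-SOLVABLE image, `ρ̄` MODULAR — here in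
Serre's shape on any algebraically closed discrete model of `ρ̄`; conclusion "(up to twist) `ρ` comes
from a cuspidal eigenform", rendered with an explicit TATE twist `χ = ε₂^m` as in the sibling
conversion `oddPrimesRegularFM_of_tateTwistModularity`). [cite: Tung2020, Thm. 1 (p. 4) and Thm. 8.0.4 (p. 32) of arXiv:1908.06174] -/
def Tung2020Shape : Prop :=
  ∀ (ρ : FramedGaloisRep ℚ (PadicAlgCl 2) 2),
    (∀ᶠ v : HeightOneSpectrum (𝓞 ℚ) in cofinite, ρ.IsUnramifiedAt v) →
    ρ.toGaloisRep.IsIrreducible → ρ.IsOdd →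
    ¬ IsSolvable ρ.residualRep.range →
    (∀ (v : HeightOneSpectrum (𝓞 ℚ)) (hv : ((2 : ℕ) : 𝓞 ℚ) ∈ v.asIdeal),
        (Literature.NumberTheory.PAdicHodge.fontainePstAdicCompletion v 2 hv).IsDeRhamFramed (ρ.toLocal v) ∧
        ∀ τ : v.adicCompletion ℚ →+* PadicAlgCl 2, Continuous τ →
          (ρ.labelledHodgeTateWeightsAt v (Literature.NumberTheory.PAdicHodge.fontainePstAdicCompletion v 2 hv).algebra
            (Literature.NumberTheory.PAdicHodge.fontainePstAdicCompletion v 2 hv).𝔅 τ).Nodup) →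
    ∀ (k : Type) [Field k] [TopologicalSpace k] [DiscreteTopology k] [CharP k 2] [IsAlgClosed k]
      (ι : padicAlgClResidueField 2 →+* k) (τ : FramedGaloisRep ℚ k 2),
      (τ : absoluteGaloisGroup ℚ →* GL (Fin 2) k) =
          (Matrix.GeneralLinearGroup.map ι).comp ρ.residualRep →
      IsSerreModularTwo τ →
      ∃ (χ : absoluteGaloisGroup ℚ →ₜ* (PadicAlgCl 2)ˣ) (m : ℤ),
        (∀ σ, χ σ = cyclotomicPadicAlgCl ℚ 2 σ ^ m) ∧
        ∃ (N : ℕ) (_ : NeZero N) (w : ℤ) (f : CuspForm (Gamma1 N) w)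
          (ιf : coeffCharField f →+* PadicAlgCl 2),
          IsNewform1 f ∧ IsGaloisRepOfNewform1 f ιf {q | q ∣ N * 2} (FramedRep.twist ρ χ)

/-- **The composition the line must prove** (crux-plan stage): the fact, Khare–Wintenberger (in-tree
named fact, all `p`, `k`) and the (prime-blind) newform → `L`-algebraic `π` conversion give the route
decl BY NAME. [folklore] -/
def LineShape : Prop :=
  Tung2020Shape →
    (∀ (p : ℕ) [Fact p.Prime] (k : Type) [Field k] [TopologicalSpace k] [DiscreteTopology k],
      khare_wintenberger p k) →
    Summit.Langlands.Langlands.Theses.DyadicOddResidue.DyadicNonsolvableFM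

/-- The in-tree Khare–Wintenberger fact is what discharges the Serre-shaped hypothesis: the weak form
at `p = 2` is literally `IsSerreModularTwo` (statement only; the in-tree theorem
`exists_newform_of_khare_wintenberger_two` of route ParityBlindBianchi proves this with `w ∈ {2, 4}`).
[folklore] -/
def KWDischargeShape : Prop :=
  (∀ (k : Type) [Field k] [TopologicalSpace k] [DiscreteTopology k], khare_wintenberger 2 k) →
    ∀ (k : Type) [Field k] [TopologicalSpace k] [DiscreteTopology k] [CharP k 2] [IsAlgClosed k]
      (τ : FramedGaloisRep ℚ k 2), τ.toGaloisRep.IsIrreducible → τ.IsOdd → IsSerreModularTwo τ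

/-! ### In-Lean falsifier run at ideation: everything but the First Lemma, the fact and the
`p = 2` clone of the conversion is ALREADY in the tree, and the binders line up. -/

/-- **KW discharges the Serre-shaped hypothesis (PROVED, in-tree ingredients only)**: the weak form of
Serre's conjecture at `p = 2` for an irreducible `τ` over an algebraically closed discrete `k` of
characteristic `2` is the in-tree `exists_newform_of_khare_wintenberger_two` (route ParityBlindBianchi),
read off the named fact `khare_wintenberger 2 k`; oddness is not even needed (automatic at `2`).
[cite: KhareWintenberger2009, Thm. 1.2 and Thm. 9.1] -/
theorem kwDischarge : KWDischargeShape := by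
  intro hKW k _ _ _ _ _ τ hirr _
  obtain ⟨N, hN, w, f, ιf, -, -, hf, hρ⟩ :=
    Summit.Langlands.Langlands.Theorems.ResidualBianchiDoorMod2.exists_newform_of_khare_wintenberger_two
      (hKW k) τ hirr
  exact ⟨N, hN, w, f, ιf, hf, hρ⟩

/-- A discrete, algebraically closed model of `𝔽̄₂` receiving `ℤ̄₂/𝔪`: the algebraic closure of the
residue field of `ℤ̄₂`, with the discrete topology. [folklore] -/
abbrev Fbar2 : Type := AlgebraicClosure (padicAlgClResidueField 2)

instance : TopologicalSpace Fbar2 := ⊥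
instance : DiscreteTopology Fbar2 := ⟨rfl⟩
instance : CharP Fbar2 2 := by
  haveI : CharP (padicAlgClResidueField 2) 2 := charP_padicAlgClResidueField 2
  exact (Algebra.charP_iff (padicAlgClResidueField 2) Fbar2 2).mp inferInstance

/-- **The `p = 2` clone of the sibling conversion** (`oddPrimesRegularFM_of_tateTwistModularity` with
`ℓ ≠ 2` replaced by `ℓ = 2` and the two residual hypotheses threaded through; its accepted proof body is
prime-blind: conjugate newform → `L`-algebraic `π₂`, norm twist `π₂ ⊗ |det|^{-m}`, `ε(Frob_q) = q`,
`arithFrobPolyOfSatake_one_rootsInv_smul`). Statement only. [folklore] -/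
def ConversionTwo : Prop :=
  (∀ (ρ : FramedGaloisRep ℚ (PadicAlgCl 2) 2),
      ρ.IsResiduallyAbsIrreducible → ¬ IsSolvable ρ.residualRep.range →
      (∀ᶠ v : HeightOneSpectrum (𝓞 ℚ) in cofinite, ρ.IsUnramifiedAt v) →
      ρ.toGaloisRep.IsIrreducible → ρ.IsOdd →
      (∀ (v : HeightOneSpectrum (𝓞 ℚ)) (hv : ((2 : ℕ) : 𝓞 ℚ) ∈ v.asIdeal),
          (Literature.NumberTheory.PAdicHodge.fontainePstAdicCompletion v 2 hv).IsDeRhamFramed (ρ.toLocal v) ∧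
          ∀ τ : v.adicCompletion ℚ →+* PadicAlgCl 2, Continuous τ →
            (ρ.labelledHodgeTateWeightsAt v (Literature.NumberTheory.PAdicHodge.fontainePstAdicCompletion v 2 hv).algebra
              (Literature.NumberTheory.PAdicHodge.fontainePstAdicCompletion v 2 hv).𝔅 τ).Nodup) →
      ∃ (χ : absoluteGaloisGroup ℚ →ₜ* (PadicAlgCl 2)ˣ) (m : ℤ),
        (∀ σ, χ σ = cyclotomicPadicAlgCl ℚ 2 σ ^ m) ∧
        ∃ (N : ℕ) (_ : NeZero N) (w : ℤ) (f : CuspForm (Gamma1 N) w)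
          (ιf : coeffCharField f →+* PadicAlgCl 2),
          IsNewform1 f ∧ IsGaloisRepOfNewform1 f ιf {q | q ∣ N * 2} (FramedRep.twist ρ χ)) →
    Summit.Langlands.Langlands.Theses.DyadicOddResidue.DyadicNonsolvableFM

/-- **The line closes modulo its three new pieces (PROVED composition)**: First Lemma (Serre avatar)
+ the named fact in the proposed shape + the `p = 2` conversion clone ⟹ `LineShape`, the residual
hypothesis of the fact being discharged by `kwDischarge` on the avatar over `Fbar2`. [folklore] -/
theorem lineShape_of (h1 : FirstLemma) (hconv : ConversionTwo) : LineShape := by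
  intro hT hKW
  apply hconv
  intro ρ _hres hns hunr hirr hodd hdR
  obtain ⟨τ, hτ, hirrτ, hoddτ⟩ := h1 ρ hns Fbar2 (algebraMap (padicAlgClResidueField 2) Fbar2)
  have hmod : IsSerreModularTwo τ :=
    kwDischarge (fun k _ _ _ => hKW 2 k) Fbar2 τ hirrτ hoddτ
  exact hT ρ hunr hirr hodd hns hdR Fbar2 (algebraMap _ Fbar2) τ hτ hmod

/-! ### The First Lemma itself (attempted at ideation; in-tree ingredients only) -/

section FirstLemmaProof

open IsLocalRing Literature.NumberTheory.EllipticCurves.ModularForms.DeligneSerre1974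

/-- A group homomorphism out of a topological group whose kernel is open is continuous (local copy of
the tree's `MonoidHom.continuous_of_isOpen_ker`, to keep the imports light). [folklore] -/
theorem continuous_of_isOpen_ker_aux {G H : Type*} [Group G] [TopologicalSpace G]
    [IsTopologicalGroup G] [Group H] [TopologicalSpace H] [ContinuousMul H] (f : G →* H)
    (hf : IsOpen (f.ker : Set G)) : Continuous f := by
  apply continuous_of_continuousAt_one f
  rw [ContinuousAt, map_one]
  intro U hU
  rw [Filter.mem_map]
  apply Filter.mem_of_superset (hf.mem_nhds (by simp))
  intro g hg
  rw [SetLike.mem_coe, MonoidHom.mem_ker] at hg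
  rw [Set.mem_preimage, hg]
  exact mem_of_mem_nhds hU

/-- **The chosen residual representation `ρ.residualRep` of `ρ : Γ_ℚ → GL₂(ℚ̄₂)` has open kernel**
as soon as it is a genuine residual representation: it is a semisimplification `σ` of a reduction
`τ₀ = Q (ρ₀ mod 𝔪) Q⁻¹` of an integral model `ρ₀` over `ℤ̄₂`, `ker τ₀ ≤ ker σ`
(`IsSemisimplificationOf`), and `ker (ρ₀ mod 𝔪)` is open because `𝔪 = {|x| < 1}` is open in `ℚ̄₂`
(in-tree `isOpen_ker_residualRep`, Deligne–Serre 1974, 6.12). [cite: DeligneSerreASENS1974, 6.12] -/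
theorem isOpen_ker_residualRep_two (ρ : FramedGaloisRep ℚ (PadicAlgCl 2) 2)
    (hex : ∃ τ, ρ.IsResidualRepOf (RingHom.id _) τ) :
    IsOpen (ρ.residualRep.ker : Set (absoluteGaloisGroup ℚ)) := by
  obtain ⟨τ₀, ⟨ρ₀, Q, ⟨P, hP⟩, hτ₀⟩, hss⟩ := ρ.residualRep_spec hex
  have hmemO : ∀ x : PadicAlgCl 2, x ∈ (padicAlgClIntegers 2) ↔ Valued.v x ≤ 1 := fun x ↦
    Valuation.mem_valuationSubring_iff _ _
  have hmopen : IsOpen {x : PadicAlgCl 2 | ∃ h : x ∈ padicAlgClIntegers 2,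
      (⟨x, h⟩ : padicAlgClIntegers 2) ∈ maximalIdeal (padicAlgClIntegers 2)} := by
    have hmax : {x : PadicAlgCl 2 | ∃ h : x ∈ padicAlgClIntegers 2,
        (⟨x, h⟩ : padicAlgClIntegers 2) ∈ maximalIdeal (padicAlgClIntegers 2)} =
        {x : PadicAlgCl 2 | Valued.v x < 1} := by
      ext x
      constructor
      · rintro ⟨hx, hm⟩
        exact (mem_maximalIdeal_padicAlgClIntegers_iff ⟨x, hx⟩).mp hm
      · intro hx
        exact ⟨(hmemO x).mpr (le_of_lt hx), (mem_maximalIdeal_padicAlgClIntegers_iff _).mpr hx⟩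
    rw [hmax]
    have hball : {x : PadicAlgCl 2 | Valued.v x < 1} = Metric.ball (0 : PadicAlgCl 2) 1 := by
      ext x
      simp only [Set.mem_setOf_eq, Metric.mem_ball, dist_zero_right]
      rw [PadicAlgCl.valuation_def, ← NNReal.coe_lt_coe, coe_nnnorm, NNReal.coe_one]
    rw [hball]
    exact Metric.isOpen_ball
  have hker₀ : IsOpen ((((Matrix.GeneralLinearGroup.map (residue (padicAlgClIntegers 2))).comp ρ₀).ker :
      Subgroup (absoluteGaloisGroup ℚ)) : Set (absoluteGaloisGroup ℚ)) :=
    Literature.NumberTheory.GaloisRepresentations.isOpen_ker_residualRep hmopen hP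
  refine Subgroup.isOpen_mono ?_ hker₀
  intro g hg
  rw [MonoidHom.mem_ker] at hg
  apply hss.2.2
  rw [MonoidHom.mem_ker, hτ₀ g]
  have hred : integralReduction (RingHom.id _) ρ₀ g = 1 := by
    change Matrix.GeneralLinearGroup.map ((RingHom.id _).comp (residue (padicAlgClIntegers 2))) (ρ₀ g) = 1
    rw [RingHom.id_comp]
    exact hg
  rw [hred, mul_one, mul_inv_cancel]

/-- **The First Lemma holds** (the Serre avatar): PROVED from in-tree ingredients —
`isOpen_ker_residualRep_two`, `isSolvable_range_of_not_isIrreducible`, `isOdd_of_charP_two`,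
`generalLinearGroup_map_injective_of_injective`; the junk value `residualRep = 1` is excluded by the
non-solvability hypothesis itself. [folklore] -/
theorem firstLemma_holds : FirstLemma := by
  intro ρ hns k _ _ _ _ ι
  classical
  have hex : ∃ τ, ρ.IsResidualRepOf (RingHom.id _) τ := by
    by_contra h
    apply hns
    have h1 : ρ.residualRep = 1 := by
      rw [FramedGaloisRep.residualRep, dif_neg h]
    rw [h1, MonoidHom.range_one]
    infer_instance
  have hker := isOpen_ker_residualRep_two ρ hex
  set σ : absoluteGaloisGroup ℚ →* GL (Fin 2) k :=
    (Matrix.GeneralLinearGroup.map ι).comp ρ.residualRep with hσ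
  have hσker : IsOpen (σ.ker : Set (absoluteGaloisGroup ℚ)) := by
    refine Subgroup.isOpen_mono ?_ hker
    intro g hg
    rw [MonoidHom.mem_ker] at hg ⊢
    rw [hσ, MonoidHom.comp_apply, hg, map_one]
  let τ : FramedGaloisRep ℚ k 2 := ⟨σ, continuous_of_isOpen_ker_aux σ hσker⟩
  refine ⟨τ, rfl, ?_, Summit.Langlands.Langlands.Theorems.ResidualBianchiDoorMod2.isOdd_of_charP_two τ⟩
  by_contra hirr
  have hsol : IsSolvable σ.range :=
    Summit.Langlands.Langlands.Theorems.ResidualBianchiDoorMod2.isSolvable_range_of_not_isIrreducible σ hirr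
  apply hns
  have hinj : Function.Injective (Matrix.GeneralLinearGroup.map (n := Fin 2) ι) :=
    generalLinearGroup_map_injective_of_injective ι ι.injective
  have hmem : ∀ x : ρ.residualRep.range, Matrix.GeneralLinearGroup.map ι (x : GL (Fin 2) _) ∈ σ.range := by
    rintro ⟨_, g, rfl⟩
    exact ⟨g, rfl⟩
  let f : ρ.residualRep.range →* σ.range :=
    { toFun := fun x => ⟨Matrix.GeneralLinearGroup.map ι (x : GL (Fin 2) _), hmem x⟩
      map_one' := by ext1; simp
      map_mul' := fun x y => by ext1; simp }
  have hf : Function.Injective f := by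
    rintro ⟨a, ha⟩ ⟨b, hb⟩ h
    have h' : Matrix.GeneralLinearGroup.map ι a = Matrix.GeneralLinearGroup.map ι b :=
      congrArg Subtype.val h
    exact Subtype.ext (hinj h')
  exact solvable_of_solvable_injective hf

end FirstLemmaProof

/-- **Corollary (everything proved except the two fact-shaped inputs)**: the line is
`Tung2020Shape → ConversionTwo → (∀ p k, khare_wintenberger p k) → DyadicNonsolvableFM`. [folklore] -/
theorem dyadicNonsolvableFM_of_shapes (hconv : ConversionTwo) : LineShape :=
  lineShape_of firstLemma_holds hconv

/-! ### The `ℓ = 2` clone of the sibling conversion (proof body of the ACCEPTED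
`Summit.Langlands.Langlands.Theorems.oddPrimesRegularFM_of_tateTwistModularity`, p142510, with `ℓ ≠ 2`
replaced by `ℓ = 2`; its helper lemmas are copied verbatim so that this file does not wait for that olean) -/

section ConversionProof

open scoped Classical Polynomial
open Polynomial
open Summit.Langlands.Langlands.Cruxes.SerreKWAutomorphicGL2.AdelicNewformDatumDoubleTwist
open Summit.Langlands.Langlands.Theorems
open Rat.HeightOneSpectrum

/-! ### Helper lemmas copied verbatim from the sibling file (accepted p142510), so that this check
does not wait for its olean -/

/-! ## The cyclotomic character at the good places -/

section Cyclotomic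

variable {K : Type} [Field K] [NumberField K] (p : ℕ) [Fact p.Prime]

/-- **`ε_p` is unramified away from `p`** (with `ℚ̄_p`-coefficients): for a finite place `v ∤ p`
of a number field, a prime `𝔓 ∣ v` of `\bar ℤ_K` and `σ ∈ I_𝔓`, `ε_p(σ) = 1` — inertia prime to
`p` fixes `μ_{p^∞}` (`smul_eq_self_of_mem_inertia_of_pow_prime_pow_eq_one`) and the cyclotomic
character is `1` on such `σ` (`cyclotomicCharacter_eq_one_of_forall_pow_eq_one`).
Serre 1968, Ch. I §1.2 (Example). [cite: SerreAbelianLadic1968, Ch. I §1.2 (Example: the cyclotomic character)] -/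
theorem cyclotomicPadicAlgCl_eq_one_of_mem_inertia {v : HeightOneSpectrum (𝓞 K)}
    (hv : (p : 𝓞 K) ∉ v.asIdeal) {𝔓 : Ideal (absIntegers (𝓞 K) K)} (h𝔓 : 𝔓 ∈ v.primesAbove)
    {σ : absoluteGaloisGroup K} (hσ : σ ∈ 𝔓.inertia (absoluteGaloisGroup K)) :
    cyclotomicPadicAlgCl K p σ = 1 := by
  have hχ : GaloisRep.cyclotomicCharacter K p σ = 1 := by
    rw [GaloisRep.cyclotomicCharacter_apply]
    exact cyclotomicCharacter_eq_one_of_forall_pow_eq_one p _ fun n t ht =>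
      smul_eq_self_of_mem_inertia_of_pow_prime_pow_eq_one hv h𝔓 hσ ht
  change Units.map (algebraMap ℤ_[p] (PadicAlgCl p) : ℤ_[p] →* PadicAlgCl p)
    (GaloisRep.cyclotomicCharacter K p σ) = 1
  rw [hχ, map_one]

/-- **`ε_p(Frob_v) = N v`** (with `ℚ̄_p`-coefficients): for `v ∤ p`, `𝔓 ∣ v` and an arithmetic
Frobenius `σ` at `𝔓`, `ε_p(σ) = N v` in `ℚ̄_p` (`GaloisRep.cyclotomicCharacter_apply_of_isArithFrobAt`).
Serre 1968, Ch. I §1.2 (Example). [cite: SerreAbelianLadic1968, Ch. I §1.2 (Example: the cyclotomic character)] -/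
theorem coe_cyclotomicPadicAlgCl_of_isArithFrobAt {v : HeightOneSpectrum (𝓞 K)}
    (hv : (p : 𝓞 K) ∉ v.asIdeal) {𝔓 : Ideal (absIntegers (𝓞 K) K)} (h𝔓 : 𝔓 ∈ v.primesAbove)
    {σ : absoluteGaloisGroup K} (hσ : IsArithFrobAt (𝓞 K) σ 𝔓) :
    ((cyclotomicPadicAlgCl K p σ : (PadicAlgCl p)ˣ) : PadicAlgCl p) = (v.residueCard : PadicAlgCl p) := by
  rw [coe_cyclotomicPadicAlgCl_apply, GaloisRep.cyclotomicCharacter_apply_of_isArithFrobAt hv h𝔓 hσ]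
  simp

end Cyclotomic

/-! ## Twisting back: ramification and Frobenius polynomials of `ρ` from those of `ρ ⊗ χ` -/

section TwistBack

variable {G : Type*} [Group G] [TopologicalSpace G] {A : Type*} [Field A] [TopologicalSpace A]
  [IsTopologicalRing A]

/-- **Characteristic polynomial of `ρ(g)` from that of `(ρ ⊗ χ)(g)`** in rank `2`: if
`charpoly (ρ ⊗ χ)(g) = X² - a X + b` then `charpoly ρ(g) = X² - χ(g)⁻¹ a X + χ(g)⁻² b`
(`ρ(g) = χ(g)⁻¹ · (ρ ⊗ χ)(g)`; `charpoly` of a `2 × 2` matrix is `X² - tr X + det`). [folklore] -/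
theorem charpoly_eq_of_charpoly_twist_eq (ρ : FramedRep G A 2) (χ : G →ₜ* Aˣ) (g : G) {a b : A}
    (h : FramedRep.charpoly (ρ.twist χ) g = X ^ 2 - C a * X + C b) :
    FramedRep.charpoly ρ g =
      X ^ 2 - C (((χ g : Aˣ) : A)⁻¹ * a) * X + C ((((χ g : Aˣ) : A)⁻¹) ^ 2 * b) := by
  set M : Matrix (Fin 2) (Fin 2) A := ((ρ.twist χ g : GL (Fin 2) A) : Matrix (Fin 2) (Fin 2) A)
    with hMdef
  have hc : ((χ g : Aˣ) : A) ≠ 0 := Units.ne_zero _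
  have hM : ((ρ g : GL (Fin 2) A) : Matrix (Fin 2) (Fin 2) A) = ((χ g : Aˣ) : A)⁻¹ • M := by
    rw [hMdef, FramedRep.coe_twist_apply, smul_smul, inv_mul_cancel₀ hc, one_smul]
  have hM2 : M.charpoly = X ^ 2 - C a * X + C b := h
  rw [Matrix.charpoly_fin_two] at hM2
  have htr : M.trace = a := by
    have := congrArg (fun P : A[X] => P.coeff 1) hM2
    simpa using this
  have hdet : M.det = b := by
    have := congrArg (fun P : A[X] => P.coeff 0) hM2
    simpa using this
  change ((ρ g : GL (Fin 2) A) : Matrix (Fin 2) (Fin 2) A).charpoly = _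
  rw [hM, Matrix.charpoly_fin_two, Matrix.trace_smul, Matrix.det_smul, Fintype.card_fin, htr, hdet,
    smul_eq_mul]

/-- If `ρ ⊗ χ` kills `g` and `χ(g) = 1` then `ρ` kills `g`. [folklore] -/
theorem apply_eq_one_of_twist_apply_eq_one {n : ℕ} (ρ : FramedRep G A n) (χ : G →ₜ* Aˣ) {g : G}
    (hχ : χ g = 1) (h : ρ.twist χ g = 1) : ρ g = 1 := by
  rw [← FramedRep.twist_apply_of_eq_one ρ χ hχ]
  exact h

end TwistBack

/-! ## The `L`-normalised Frobenius polynomial of rescaled inverted roots -/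

section FrobPoly

variable {p : ℕ} [Fact p.Prime]

/-- The complex roots of a monic quadratic `X² - a X + b`: `{β₁, β₂}` with `β₁ + β₂ = a`,
`β₁ β₂ = b` (`ℂ` is algebraically closed; Vieta). [folklore] -/
theorem exists_roots_eq_pair (a b : ℂ) :
    ∃ β₁ β₂ : ℂ, (X ^ 2 - C a * X + C b : ℂ[X]).roots = {β₁, β₂} ∧ β₁ + β₂ = a ∧ β₁ * β₂ = b := by
  obtain ⟨β₁, β₂, h1, h2⟩ := exists_pair_add_eq_mul_eq a b
  refine ⟨β₁, β₂, ?_, h1, h2⟩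
  have hP : (X ^ 2 - C a * X + C b : ℂ[X]) = (X - C β₁) * (X - C β₂) := by
    rw [← h1, ← h2]; simp only [map_add, map_mul]; ring
  rw [hP, Polynomial.roots_mul (mul_ne_zero (X_sub_C_ne_zero β₁) (X_sub_C_ne_zero β₂)),
    roots_X_sub_C, roots_X_sub_C]
  rfl

/-- **The `L`-normalised Frobenius polynomial of the rescaled inverted roots.**  For
`ι : ℚ̄_p ≃+* ℂ`, a complex quadratic `X² - a X + b = (X - β₁)(X - β₂)` and `w ∈ ℂ`,
`arithFrobPolyOfSatake ι q 1 (w · {β₁⁻¹, β₂⁻¹}) = ∏_j (X - ι⁻¹(w⁻¹ β_j))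
= X² - ι⁻¹(w⁻¹) ι⁻¹(a) X + ι⁻¹(w⁻¹)² ι⁻¹(b)` (Buzzard–Gee's `L`-normalisation
`α ↦ ∏ (X - ι⁻¹(α_j⁻¹))`). [cite: BuzzardGeeLMS2014, §2.1 and Rem. 3.2.5] -/
theorem arithFrobPolyOfSatake_one_rootsInv_smul (ι : PadicAlgCl p ≃+* ℂ) (q : ℕ) (a b w : ℂ) :
    arithFrobPolyOfSatake ι q 1
        ((((X ^ 2 - C a * X + C b : ℂ[X]).roots.map (·⁻¹)).map (w * ·))) =
      X ^ 2 - C (ι.symm w⁻¹ * ι.symm a) * X + C ((ι.symm w⁻¹) ^ 2 * ι.symm b) := by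
  obtain ⟨β₁, β₂, hr, h1, h2⟩ := exists_roots_eq_pair a b
  rw [arithFrobPolyOfSatake_one, hr]
  simp only [Multiset.insert_eq_cons, Multiset.map_cons, Multiset.map_singleton, Multiset.prod_cons,
    Multiset.prod_singleton, mul_inv, inv_inv, map_mul]
  rw [← h1, ← h2]
  simp only [map_add, map_mul, map_pow]
  ring

end FrobPoly


/-! ### The conversion at ℓ = 2 -/


/-- **`ConversionTwo` holds** (statement inlined): newform-up-to-Tate-twist at `ℓ = 2` for the residually
non-solvable `ρ` of the crux ⟹ the route decl `DyadicOddResidue.DyadicNonsolvableFM` — the sibling's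
conversion verbatim at `ℓ = 2` (conjugate newform → `L`-algebraic `π₂`, norm twist `π₂ ⊗ |det|^{-m}`,
`ε(Frob_q) = q`, `arithFrobPolyOfSatake_one_rootsInv_smul`). [cite: BuzzardGeeLMS2014, Conj. 3.2.2 and Rem. 3.2.5] -/
theorem conversionTwo_holds'
    (H : ∀ (ρ : FramedGaloisRep ℚ (PadicAlgCl 2) 2),
      ρ.IsResiduallyAbsIrreducible → ¬ IsSolvable ρ.residualRep.range →
      (∀ᶠ v : HeightOneSpectrum (𝓞 ℚ) in cofinite, ρ.IsUnramifiedAt v) →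
      ρ.toGaloisRep.IsIrreducible → ρ.IsOdd →
      (∀ (v : HeightOneSpectrum (𝓞 ℚ)) (hv : ((2 : ℕ) : 𝓞 ℚ) ∈ v.asIdeal),
          (Literature.NumberTheory.PAdicHodge.fontainePstAdicCompletion v 2 hv).IsDeRhamFramed (ρ.toLocal v) ∧
          ∀ τ : v.adicCompletion ℚ →+* PadicAlgCl 2, Continuous τ →
            (ρ.labelledHodgeTateWeightsAt v (Literature.NumberTheory.PAdicHodge.fontainePstAdicCompletion v 2 hv).algebra
              (Literature.NumberTheory.PAdicHodge.fontainePstAdicCompletion v 2 hv).𝔅 τ).Nodup) →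
      ∃ (χ : absoluteGaloisGroup ℚ →ₜ* (PadicAlgCl 2)ˣ) (m : ℤ),
        (∀ σ, χ σ = cyclotomicPadicAlgCl ℚ 2 σ ^ m) ∧
        ∃ (N : ℕ) (_ : NeZero N) (w : ℤ) (f : CuspForm (Gamma1 N) w)
          (ιf : coeffCharField f →+* PadicAlgCl 2),
          IsNewform1 f ∧ IsGaloisRepOfNewform1 f ιf {q | q ∣ N * 2} (FramedRep.twist ρ χ)) :
    Summit.Langlands.Langlands.Theses.DyadicOddResidue.DyadicNonsolvableFM := by
  intro ℓ _ hℓ ρ hres hns hirr hodd hunr hdR hcpt ι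
  subst hℓ
  have hℓp : (2 : ℕ).Prime := Fact.out
  obtain ⟨χ, m, hχ, N, _, k, f, ιf, hf, hρ'⟩ := H ρ hres hns hunr hirr hodd hdR
  -- the automorphic side: `π₂ = π(f^τ)` (L-normalised) and its norm twist `π = π₂ ⊗ |det|^{-m}`
  set τ : coeffCharField f →+* ℂ := (ι : PadicAlgCl 2 →+* ℂ).comp ιf with hτdef
  obtain ⟨π₂, ⟨T, hT, hTL⟩, hsat₂⟩ :=
    exists_isLAlgebraic_hasSatakeParamAt_rootsInv_of_isNewform1 hf τ hcpt
  obtain ⟨η, π, hη, hW, hW', hTπ⟩ :=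
    CuspidalAutomorphicRepData.exists_twist_hasInfinityType π₂ (((-m : ℤ) : ℝ)) hT
  refine ⟨π, ⟨_, hTπ, ?_⟩, ?_⟩
  · rw [Complex.ofReal_intCast]
    exact (InfinityType.isLAlgebraic_twist_intCast_iff T (-m)).2 hTL
  have hgood := eventually_not_dvd (n := N * 2) (mul_ne_zero (NeZero.ne N) hℓp.ne_zero)
  filter_upwards [hsat₂, hgood] with v hv₂ hvNℓ
  -- notation at the good place `v`: `q = p_v`, `q ∤ N ℓ`
  have hq : ((Rat.HeightOneSpectrum.primesEquiv v : Nat.Primes) : ℕ) = natGenerator v := rfl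
  have hℓv : ((2 : ℕ) : 𝓞 ℚ) ∉ v.asIdeal := fun h =>
    hvNℓ (hq ▸ Dvd.dvd.mul_left ((Rat.natCast_mem_asIdeal_iff v).1 h) N)
  obtain ⟨hunr', hfrob'⟩ := hρ' v hvNℓ
  have hsatπ := AutomorphicRepData.HasSatakeParamAt.of_map_mulChar_detTwist_of_cpow hη hW hW' hv₂
  refine ⟨_, hsatπ, ?_, ?_⟩
  · -- `ρ` is unramified at `v`: `ρ ⊗ ε^m` is, and `ε` is
    intro 𝔓 h𝔓 σ hσ
    refine apply_eq_one_of_twist_apply_eq_one ρ χ ?_ (hunr' 𝔓 h𝔓 σ hσ)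
    rw [hχ, cyclotomicPadicAlgCl_eq_one_of_mem_inertia 2 hℓv h𝔓 hσ, one_zpow]
  · -- the Frobenius polynomial
    intro 𝔓 h𝔓 σ hσ
    have h2 := hfrob' 𝔓 h𝔓 σ hσ
    -- the Hecke polynomial of `f` at `q`, along `ι_f` and along `τ = ι ∘ ι_f`
    set aK : coeffCharField f := ⟨(UpperHalfPlane.qExpansion 1 ⇑f).coeff (natGenerator v),
      cuspCoeff_mem_coeffCharField f _⟩ with haK
    set bK : coeffCharField f := ⟨(nebentypus f ((natGenerator v : ℕ) : ZMod N) : ℂ) *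
        ((natGenerator v : ℕ) : ℂ) ^ (k - 1), nebentypus_mul_zpow_mem_coeffCharField f _⟩ with hbK
    have hH : heckePolynomial f (natGenerator v) = X ^ 2 - C aK * X + C bK := rfl
    rw [hq, hH, Polynomial.map_add, Polynomial.map_sub, Polynomial.map_mul, Polynomial.map_pow,
      map_X, map_C, map_C] at h2
    have hρσ := charpoly_eq_of_charpoly_twist_eq ρ χ σ h2
    -- `χ(σ) = ε(σ)^m = q^m`
    have hc : ((χ σ : (PadicAlgCl 2)ˣ) : PadicAlgCl 2) = ((natGenerator v : ℕ) : PadicAlgCl 2) ^ m := by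
      rw [hχ, Units.val_zpow_eq_zpow_val, coe_cyclotomicPadicAlgCl_of_isArithFrobAt 2 hℓv h𝔓 hσ,
        Rat.residueCard_eq_natGenerator]
    rw [hρσ, hq, hH, Polynomial.map_add, Polynomial.map_sub, Polynomial.map_mul, Polynomial.map_pow,
      map_X, map_C, map_C, arithFrobPolyOfSatake_one_rootsInv_smul]
    -- compare coefficients: `ι⁻¹(w⁻¹) = q^{-m} = χ(σ)⁻¹`, `ι⁻¹ ∘ τ = ι_f`
    have hw : ι.symm ((v.residueCard : ℂ) ^ (-((((-m : ℤ) : ℝ)) : ℂ)))⁻¹ =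
        (((natGenerator v : ℕ) : PadicAlgCl 2) ^ m)⁻¹ := by
      rw [Rat.residueCard_eq_natGenerator, Complex.ofReal_intCast, ← Int.cast_neg, neg_neg,
        Complex.cpow_intCast, map_inv₀, map_zpow₀, map_natCast]
    have hτ : ∀ x : coeffCharField f, ι.symm (τ x) = ιf x := fun x => by
      rw [hτdef, RingHom.comp_apply]
      exact ι.symm_apply_apply _
    rw [hw, hτ, hτ, hc]


/-- `ConversionTwo` holds (the primed theorem has literally its unfolded statement). [folklore] -/
theorem conversionTwo_holds : ConversionTwo := fun H => conversionTwo_holds' H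

end ConversionProof

/-- **THE LINE, CLOSED MODULO THE ONE NEW NAMED FACT** (kernel-checked): the proposed cite fact
`Tung2020Shape` (Tung 2020, Thm. 1 / Thm. 8.0.4 over `ℚ`, Serre-shaped residual hypothesis, Tate-twist
conclusion) and the in-tree named fact `khare_wintenberger` give the route decl
`DyadicOddResidue.DyadicNonsolvableFM` BY NAME.  Axioms `propext`, `Classical.choice`, `Quot.sound`.
[cite: Tung2020, Thm. 1 (p. 4) and Thm. 8.0.4 (p. 32) of arXiv:1908.06174] [cite: KhareWintenberger2009, Thm. 1.2 and Thm. 9.1] -/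
theorem dyadicNonsolvableFM_of_facts (hT : Tung2020Shape)
    (hKW : ∀ (p : ℕ) [Fact p.Prime] (k : Type) [Field k] [TopologicalSpace k] [DiscreteTopology k],
      khare_wintenberger p k) :
    Summit.Langlands.Langlands.Theses.DyadicOddResidue.DyadicNonsolvableFM :=
  dyadicNonsolvableFM_of_shapes conversionTwo_holds hT hKW

end Summit.Langlands.Langlands.Cruxes.DyadicNonsolvableFM.SerreAvatar

end
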